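import Literature.MathematicalPhysics.QuantumFieldTheory.Balaban1983to89.T4EtaRateMin
import Summits.QuantumFields.YangMills.Theorems.BalabanUVNodesN19LipBracketTube

/-!
# BalabanUVNodes ∕ N19 — the two LOCATED instancer items of the tube reading of (T) TYPED AS SUFFICIENT CONDITIONS: (a) the C¹
# currency of NE3's closeness (two reading components, two rates; the unit check at `θ⁶ = L⁻¹`), (b) the layer indexing of the tube
# radius (the creation layer binds under a monotone (2.6)-comparable flow)
# (cell `pub-ymgap`, HUMAN RULING D-0062 Track A, node N19 = NE7, R134 seat dag-n19-c g2, strategy s1′; helper; count-neutral)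

WHY.  `BalabanUVNodesN19LipBracketTube` (p460518) produces the bracket (T) of `T4OutputRate.u3_threeBrackets` :227 from the pair-disc
shape at the printed tube radius `κ₁·α(C₁, q₁, g_j)` and leaves, in its header, TWO LOCATED items for the instancer (NODE O's unit table):
(a) the (I.1.13) ∕ [III] (2.39) tube bounds `|A′|` AND `|∇_U A′|`, so NE3's closeness must be read in a C¹ currency — value AND covariant
gradient of `Spine.NE3.CovariantRoot.closeness_of_ne3EnergyRateWCov` ((P) `θ^{8k}`, (Gᶜ) `θ^{13k}`), with the layer weights `(Lⁿξ)¹`,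
`(Lⁿξ)²` converting `k`-uniformly; (b) the pair-disc radius is indexed by the creation scale `j = scale X` alone, while (2.39) on the layer
`X ∩ (Ω_n∖Ω_{n+1})` reads `(1 − β(1 − 2^{−(j−n)}))·α_{1,n}` with the layer weight `Lⁿξ` (`ξ = L^{−j}`): is the creation layer the
binding one?  THIS FILE types both as kernel statements with explicit sufficient conditions, so a referee reads inequalities, not prose:
* §1 (item (a); lens pieces T-d ∕ T-d′ of `pub-ymgap/ym-lens-BalabanUVNodes-decomp/LENS-decomp.md`, lifted from that seat's farm-checked
  sketch `LensDecompNE7.sketch.lean` — credited): `max_le_of_two_rates`; `localRate_of_components` — a `T4EtaRateMin.LocalRate` for a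
  reading family whose sites carry TWO components (value, gradient: `X × Bool`) from the two rates, constant `C₁ + C₂`, rate `max θ₁ θ₂`
  (the liaison `T4RateLiaison.GaugeDominated` is over an ABSTRACT local-reading family, so the C¹ upgrade is an instantiation choice).
* §2 (item (a), units; lens piece T-f lifted — credited — plus the check): `rescale_rate_eq` ∕ `rescale_rate_le` — a fine-lattice rate
  `t^k` read in a layer weight `Lr^(k−j)` is `≤ t^j` uniformly in `k` as soon as `0 ≤ Lr·t ≤ 1`; `unitCheck_of_theta_six` — at N16's
  rate letter `θ⁶ = L⁻¹` (`1 ≤ L`, `0 < θ`): `L·θ⁸ ≤ 1` (sup component, weight exponent 1, rate `θ⁸`) AND `L²·θ^{13} ≤ 1` (gradient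
  component, weight exponent 2, rate `θ^{13}`) — both admissible; `L²·θ⁸ = L^{2∕3} > 1` is why the gradient component must use (Gᶜ).
* §3 (item (b), NEW): `three_halves_mul_le_two_pow` (`(3∕2)m ≤ 2^m`, `m ≥ 1`); `flowGrowth_le_layerWeight` (`(1 + β₀)√m ≤ (3∕4)L^m` for
  `m ≥ 1`, `2 ≤ L`, `0 ≤ β₀ ≤ 1∕8`); **`creationRadius_le_layerRadius`** — for `n ≤ j`, a flow MONOTONE between the two layers
  (`g_n ≤ g_j`: the β-functions are positive — (0.31) lower half ∕ `EventualLowerH`, β-side conditional, DISPLAYED) and (2.6)-COMPARABLE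
  (`g_j ≤ (1 + β₀)(j − n)^{1∕2} g_n` — [Balaban1988Convergent] (2.6) p. 255 third member VERBATIM, DISPLAYED; the tree's `B14.FlowIneq26`
  types the first and last members), `g_j² ≤ 1`, `2 ≤ L`, `0 ≤ β₀ ≤ 1∕8`, the printed `β ≤ 1∕4`, `C₁ ≥ 0`:
  `α(C₁, q₁, g_j) ≤ L^(j−n) · rad239 β (α(C₁, q₁, g_n)) j n` — the creation-layer radius (2.28) is below EVERY older layer's (2.39)
  radius read in the unweighted `|A′|`-currency, so `ϱ g j = α(C₁, q₁, g_j)` (`κ₁ = 1 = shrink β 0`) is admissible on all of `X`'s layers: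
  item (b) DISSOLVES under printed (2.6) + monotonicity + `L ≥ 2`.  One application of p460518's `alphaJ_le_mul_alphaJ_of_le` and
  `B14Radii.three_quarters_lt_shrink`.

HONEST FRAMING.  Elementary real inequalities and one instantiation-shaped lemma over the abstract `T4EtaRateMin.Readings`; THEOREMS ONLY;
0 `def`; 0 `sorry`; standard axioms.  Nothing of Bałaban's is instantiated (which layer weights, which `ξ`, which gauge — NODE O's unit table);
NE7 NOT PRINTED ∕ NOT proved; N19 NOT discharged; count-neutral; one finite four-torus at fixed ε, rung (B)+1 — NOT infinite volume, NOT OS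
on ℝ⁴, NOT a mass gap, NOT Clay.  Filed `--supports` the K3 item `SpineGivenEndpointR11`.  No decl below carries a cite tag; locators:
[Balaban1987RG1] CMP 109 (1.13) p. 262; [Balaban1988Convergent] CMP 119 (2.6) p. 255, (2.28) p. 259, (2.39) p. 261; N16's letters
`θ⁶ = L⁻¹`, (P)∕(Gᶜ) as in `Summits/…/Spine/NE3/CovariantRoot.lean` :63.
-/

open Finset

namespace Summit.QuantumFields.YangMills.BalabanUVNodes.N19TubeLiaison

open Literature.MathematicalPhysics.QuantumFieldTheory.Balaban1983to89
open T4EtaRateMin (Readings LocalRate)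
open Summit.QuantumFields.YangMills.BalabanUVNodes.N19LipBracketTube (alphaJ_le_mul_alphaJ_of_le)

/-! ## §1 Item (a): two reading components, two rates ⇒ one `LocalRate` -/

section Components

/-- **TWO GEOMETRIC BOUNDS COMBINE UNDER `max`** with the worse rate and the summed constant (`C₁, C₂, θ₁, θ₂ ≥ 0`).  Lens piece T-d,
lifted. [folklore] -/
theorem max_le_of_two_rates {a b C₁ C₂ θ₁ θ₂ : ℝ} (hC₁ : 0 ≤ C₁) (hC₂ : 0 ≤ C₂) (hθ₁ : 0 ≤ θ₁) (hθ₂ : 0 ≤ θ₂) (k : ℕ)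
    (ha : a ≤ C₁ * θ₁ ^ k) (hb : b ≤ C₂ * θ₂ ^ k) : max a b ≤ (C₁ + C₂) * (max θ₁ θ₂) ^ k := by
  have h1 : θ₁ ^ k ≤ (max θ₁ θ₂) ^ k := pow_le_pow_left₀ hθ₁ (le_max_left _ _) k
  have h2 : θ₂ ^ k ≤ (max θ₁ θ₂) ^ k := pow_le_pow_left₀ hθ₂ (le_max_right _ _) k
  have hm : 0 ≤ (max θ₁ θ₂) ^ k := pow_nonneg (hθ₁.trans (le_max_left _ _)) k
  refine max_le ?_ ?_
  · calc a ≤ C₁ * θ₁ ^ k := ha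
      _ ≤ C₁ * (max θ₁ θ₂) ^ k := mul_le_mul_of_nonneg_left h1 hC₁
      _ ≤ (C₁ + C₂) * (max θ₁ θ₂) ^ k := by nlinarith
  · calc b ≤ C₂ * θ₂ ^ k := hb
      _ ≤ C₂ * (max θ₁ θ₂) ^ k := mul_le_mul_of_nonneg_left h2 hC₂
      _ ≤ (C₁ + C₂) * (max θ₁ θ₂) ^ k := by nlinarith

/-- **A `LocalRate` FOR A TWO-COMPONENT READING FAMILY** (value at `(x, false)`, covariant gradient at `(x, true)`), from a rate for each
component: constant `C₁ + C₂`, rate `max θ₁ θ₂`.  The intended instance (NODE O): N16's covariant root (P) `sup ‖Z‖ ≤ C₁θ₁^k` with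
`θ₁ = θ⁸` and (Gᶜ) `‖∇_U Z‖ ≤ C₂θ₂^k` with `θ₂ = θ^{13}` (after §2's unit conversion), read as ONE local-reading family for the liaison
`T4RateLiaison.GaugeDominated` whose gauge is the chart's C¹ size of the tube direction.  Lens piece T-d′, lifted. [folklore] -/
theorem localRate_of_components {ι X : Type*} (R : Readings ι (X × Bool)) {C₁ C₂ θ₁ θ₂ : ℝ} (hC₁ : 0 ≤ C₁) (hC₂ : 0 ≤ C₂)
    (hθ₁ : 0 ≤ θ₁) (hθ₂ : 0 ≤ θ₂)
    (hval : ∀ k, ∀ V ∈ R.dom, ∀ x : X, |R.loc (k + 1) V (x, false) - R.loc k V (x, false)| ≤ C₁ * θ₁ ^ k)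
    (hgrad : ∀ k, ∀ V ∈ R.dom, ∀ x : X, |R.loc (k + 1) V (x, true) - R.loc k V (x, true)| ≤ C₂ * θ₂ ^ k) :
    LocalRate R (C₁ + C₂) (max θ₁ θ₂) := by
  intro k V hV p
  obtain ⟨x, b⟩ := p
  have hm : 0 ≤ (max θ₁ θ₂) ^ k := pow_nonneg (hθ₁.trans (le_max_left _ _)) k
  cases b with
  | false =>
    calc |R.loc (k + 1) V (x, false) - R.loc k V (x, false)| ≤ C₁ * θ₁ ^ k := hval k V hV x
      _ ≤ C₁ * (max θ₁ θ₂) ^ k := mul_le_mul_of_nonneg_left (pow_le_pow_left₀ hθ₁ (le_max_left _ _) k) hC₁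
      _ ≤ (C₁ + C₂) * (max θ₁ θ₂) ^ k := by nlinarith
  | true =>
    calc |R.loc (k + 1) V (x, true) - R.loc k V (x, true)| ≤ C₂ * θ₂ ^ k := hgrad k V hV x
      _ ≤ C₂ * (max θ₁ θ₂) ^ k := mul_le_mul_of_nonneg_left (pow_le_pow_left₀ hθ₂ (le_max_right _ _) k) hC₂
      _ ≤ (C₁ + C₂) * (max θ₁ θ₂) ^ k := by nlinarith

end Components

/-! ## §2 Item (a), units: a fine-lattice rate read in a layer weight; the check at `θ⁶ = L⁻¹` -/

section Units

/-- `Lr^(k−j) · t^k = (Lr·t)^(k−j) · t^j` for `j ≤ k`.  Lens piece T-f, lifted. [folklore] -/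
theorem rescale_rate_eq {Lr t : ℝ} {j k : ℕ} (hjk : j ≤ k) : Lr ^ (k - j) * t ^ k = (Lr * t) ^ (k - j) * t ^ j := by
  obtain ⟨m, rfl⟩ := Nat.exists_eq_add_of_le hjk
  rw [Nat.add_sub_cancel_left, pow_add, mul_pow]
  ring

/-- **SCALE CONVERSION OF A RATE**: a closeness `t^k` measured on run A's fine lattice (`k` steps), read in a layer weight `Lr^(k−j)`
of the creation scale `j ≤ k`, is `≤ t^j` UNIFORMLY IN `k` as soon as `0 ≤ Lr·t ≤ 1`, `0 ≤ t`.  Lens piece T-f′, lifted. [folklore] -/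
theorem rescale_rate_le {Lr t : ℝ} {j k : ℕ} (hjk : j ≤ k) (h0 : 0 ≤ Lr * t) (h1 : Lr * t ≤ 1) (ht : 0 ≤ t) :
    Lr ^ (k - j) * t ^ k ≤ t ^ j := by
  rw [rescale_rate_eq hjk]
  have hp : (Lr * t) ^ (k - j) ≤ 1 := pow_le_one₀ h0 h1
  calc (Lr * t) ^ (k - j) * t ^ j ≤ 1 * t ^ j := mul_le_mul_of_nonneg_right hp (pow_nonneg ht j)
    _ = t ^ j := one_mul _

/-- **THE UNIT CHECK AT N16's RATE LETTER `θ⁶ = L⁻¹`** (`1 ≤ L`, `0 < θ`): `L·θ⁸ ≤ 1` — the sup component ((P), rate `θ⁸`) converts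
under the weight exponent `1` of (2.39)'s `Lⁿξ|A′|` — AND `L²·θ^{13} ≤ 1` — the covariant-gradient component ((Gᶜ), rate `θ^{13}`)
converts under the weight exponent `2` of `(Lⁿξ)²|∇_U A′|`.  (Indeed `L·θ⁸ = θ² ≤ 1` and `L²·θ^{13} = θ ≤ 1`; by contrast `L²·θ⁸ =
θ^{−4} ≥ 1`, so the gradient component cannot ride on the sup rate — the located content of the lens's T-f.) [folklore] -/
theorem unitCheck_of_theta_six {L θ : ℝ} (hL : 1 ≤ L) (hθ : 0 < θ) (hθ6 : θ ^ 6 = L⁻¹) :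
    L * θ ^ 8 ≤ 1 ∧ L ^ 2 * θ ^ 13 ≤ 1 := by
  have hL0 : 0 < L := lt_of_lt_of_le one_pos hL
  have hLθ : L * θ ^ 6 = 1 := by rw [hθ6, mul_inv_cancel₀ hL0.ne']
  have hθ1 : θ ≤ 1 := by
    have h6 : θ ^ 6 ≤ 1 := by rw [hθ6]; exact inv_le_one_of_one_le₀ hL
    exact (pow_le_one_iff_of_nonneg hθ.le (by norm_num)).mp h6
  refine ⟨?_, ?_⟩
  · calc L * θ ^ 8 = (L * θ ^ 6) * θ ^ 2 := by ring
      _ = θ ^ 2 := by rw [hLθ, one_mul]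
      _ ≤ 1 := pow_le_one₀ hθ.le hθ1
  · calc L ^ 2 * θ ^ 13 = (L * θ ^ 6) ^ 2 * θ := by ring
      _ = θ := by rw [hLθ, one_pow, one_mul]
      _ ≤ 1 := hθ1

end Units

/-! ## §3 Item (b): the creation layer binds under a monotone (2.6)-comparable flow -/

section Layers

/-- `(3∕2)·m ≤ 2^m` for `m ≥ 1`. [folklore] -/
theorem three_halves_mul_le_two_pow {m : ℕ} (hm : 1 ≤ m) : (3 : ℝ) / 2 * m ≤ 2 ^ m := by
  induction m with
  | zero => exact absurd hm (by norm_num)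
  | succ n ih =>
    rcases Nat.eq_zero_or_pos n with h0 | hpos
    · subst h0; norm_num
    · have ih' := ih hpos
      have hn1 : (1 : ℝ) ≤ n := by exact_mod_cast hpos
      push_cast
      calc (3 : ℝ) / 2 * (n + 1) = 3 / 2 * n + 3 / 2 := by ring
        _ ≤ 2 ^ n + 2 ^ n := by linarith [ih']
        _ = 2 ^ (n + 1) := by ring

/-- **THE FLOW'S SQUARE-ROOT GROWTH IS BEATEN BY ONE LAYER WEIGHT**: `(1 + β₀)·√m ≤ (3∕4)·L^m` for `m ≥ 1`, `2 ≤ L`, `0 ≤ β₀ ≤ 1∕8`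
(`(9∕8)√m ≤ (9∕8)m ≤ (3∕4)2^m ≤ (3∕4)L^m`). [folklore] -/
theorem flowGrowth_le_layerWeight {β₀ L : ℝ} {m : ℕ} (hm : 1 ≤ m) (hL : 2 ≤ L) (hβ₀ : 0 ≤ β₀) (hβ₀' : β₀ ≤ 1 / 8) :
    (1 + β₀) * Real.sqrt m ≤ 3 / 4 * L ^ m := by
  have hm1 : (1 : ℝ) ≤ m := by exact_mod_cast hm
  have hsqrt : Real.sqrt (m : ℝ) ≤ m := Real.sqrt_le_iff.mpr ⟨by positivity, by nlinarith⟩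
  have h2L : (2 : ℝ) ^ m ≤ L ^ m := pow_le_pow_left₀ (by norm_num) hL m
  have h32 := three_halves_mul_le_two_pow hm
  calc (1 + β₀) * Real.sqrt m ≤ (9 / 8) * m := by
        have : (1 + β₀) * Real.sqrt m ≤ (1 + β₀) * m := mul_le_mul_of_nonneg_left hsqrt (by linarith)
        nlinarith
    _ = 3 / 4 * (3 / 2 * m) := by ring
    _ ≤ 3 / 4 * 2 ^ m := by linarith
    _ ≤ 3 / 4 * L ^ m := by linarith

/-- **THE CREATION LAYER BINDS.**  For layers `n ≤ j` of a domain created at scale `j`: if the flow is MONOTONE between them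
(`g_n ≤ g_j` — positivity of the β-functions, the (0.31) lower half; β-side conditional, displayed) and (2.6)-COMPARABLE
(`g_j ≤ (1 + β₀)(j − n)^{1∕2}·g_n`, (2.6) p. 255 third member verbatim, displayed), with `g_j² ≤ 1`, `2 ≤ L`, `0 ≤ β₀ ≤ 1∕8`, the
printed `β ≤ 1∕4` and `C₁ ≥ 0`, then the creation-layer tube radius (2.28) is below the older layer's (2.39) radius read in the
unweighted `|A′|`-currency (layer weight `(Lⁿξ)⁻¹ = L^(j−n)` at `ξ = L^{−j}`):
`α(C₁, q₁, g_j) ≤ L^(j−n) · rad239 β (α(C₁, q₁, g_n)) j n` (`= L^(j−n)·shrink β (j−n)·α(C₁, q₁, g_n)`).  Hence the radius family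
`ϱ g j = α(C₁, q₁, g_j)` of `N19LipBracketTube` §3 (`κ₁ = 1`) respects (2.39) on every layer the domain meets — located item (b) of
that file's header dissolves under these printed-grade conditions.  (`n = j`: equality, `shrink β 0 = 1`; `n < j`: p460518's
`alphaJ_le_mul_alphaJ_of_le` with `M = (3∕4)L^(j−n)` from `flowGrowth_le_layerWeight`, then `3∕4 < shrink β (j−n)`.) [folklore] -/
theorem creationRadius_le_layerRadius {C₁ β β₀ L : ℝ} {q₁ : ℕ} {g : ℕ → ℝ} {n j : ℕ} (hnj : n ≤ j)
    (hC₁ : 0 ≤ C₁) (hβ : β ≤ 1 / 4) (hL : 2 ≤ L) (hβ₀ : 0 ≤ β₀) (hβ₀' : β₀ ≤ 1 / 8)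
    (hgn : 0 < g n) (hmono : g n ≤ g j) (hcomp : g j ≤ (1 + β₀) * Real.sqrt ((j : ℝ) - n) * g n) (hg1 : g j ^ 2 ≤ 1) :
    B14.alphaJ C₁ q₁ (g j) ≤ L ^ (j - n) * B14Radii.rad239 β (B14.alphaJ C₁ q₁ (g n)) j n := by
  unfold B14Radii.rad239
  rcases Nat.eq_or_lt_of_le hnj with h | hlt
  · -- the creation layer itself: `shrink β 0 = 1`, weight `L^0 = 1`
    subst h
    simp
  · -- an older layer: comparability beats the square-root growth by one layer weight
    obtain ⟨m, rfl⟩ := Nat.exists_eq_add_of_lt hlt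
    have hm : n + m + 1 - n = m + 1 := by omega
    rw [hm]
    have hm1 : 1 ≤ m + 1 := Nat.le_add_left 1 m
    have hcast : ((n + m + 1 : ℕ) : ℝ) - n = ((m + 1 : ℕ) : ℝ) := by push_cast; ring
    rw [hcast] at hcomp
    have hgrowth := flowGrowth_le_layerWeight hm1 hL hβ₀ hβ₀'
    have hM : g (n + m + 1) ≤ 3 / 4 * L ^ (m + 1) * g n :=
      hcomp.trans (mul_le_mul_of_nonneg_right hgrowth hgn.le)
    have hα := alphaJ_le_mul_alphaJ_of_le q₁ hC₁ hgn hmono hM hg1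
    have hshrink := B14Radii.three_quarters_lt_shrink hβ (m + 1)
    have hαn : 0 ≤ B14.alphaJ C₁ q₁ (g n) := by
      unfold B14.alphaJ
      have hgn1 : g n ^ 2 ≤ 1 := (pow_le_pow_left₀ hgn.le hmono 2).trans hg1
      have hlog : 0 ≤ Real.log (g n ^ 2)⁻¹ := by
        rw [Real.log_inv]
        have := Real.log_nonpos (by positivity : 0 ≤ g n ^ 2) hgn1
        linarith
      exact mul_nonneg (mul_nonneg hgn.le hC₁) (pow_nonneg hlog q₁)
    have hLm : 0 ≤ L ^ (m + 1) := pow_nonneg (by linarith) _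
    calc B14.alphaJ C₁ q₁ (g (n + m + 1)) ≤ 3 / 4 * L ^ (m + 1) * B14.alphaJ C₁ q₁ (g n) := hα
      _ = L ^ (m + 1) * (3 / 4 * B14.alphaJ C₁ q₁ (g n)) := by ring
      _ ≤ L ^ (m + 1) * (B14Radii.shrink β (m + 1) * B14.alphaJ C₁ q₁ (g n)) :=
          mul_le_mul_of_nonneg_left (mul_le_mul_of_nonneg_right hshrink.le hαn) hLm

end Layers

end Summit.QuantumFields.YangMills.BalabanUVNodes.N19TubeLiaison
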